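/-
Copyright: cell pub-balaban-gaps (YM BLITZ Y1, track G1), seat g1-p2 GEN 5 (unit `pub-balaban-gaps-g1-p2`).  Row (D4) NODE O,
OBJECT ∕ MECHANISM level: the row's first-missing-lemma SHAPE `ExistsUniformAcrossSmall` ((v)⁺) INHABITED ACROSS ANY FAMILY OF
TORI BY THE GENUINE INVERSE OF A UNIFORMLY ACCRETIVE, FINITE-RANGE, HOLOMORPHIC OPERATOR FAMILY `Δ′(u) = 1 + K′(u)` — the
parametrix model of `D4WalkModelParametrix` with its local inverses CONSTRUCTED (`D4WalkBlockLocalInverse`) and its commutator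
letters DERIVED (`D4WalkBlockCommutator`): every hypothesis is a letter ON `Δ′` (range, block bound, holomorphy, reality,
conjugated coercivity), on the partition, or geometry ∕ numerics; COMMON letters across the family.
HONEST FRAMING: model ∕ mechanism; Bałaban's `Δ^{(k)}(𝐔)` with these letters k-UNIFORMLY ([B9] Thms 3.1–3.3) is NOT
constructed ∕ proved; precision ∕ covariance slots FREE; (D4) NOT discharged (instance 0∕1); NOT BetaPertH, NOT continuum, NOT Clay.
-/
import Summits.QuantumFields.BalabanUV.Gaps.D4WalkModelParametrix
import Summits.QuantumFields.BalabanUV.Gaps.D4WalkBlockLocalInverse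

/-!
# `Gaps.D4WalkModelAccretive` — (v)⁺ across tori for the inverse of any uniformly accretive finite-range holomorphic
`Δ′(u)`, letters on `Δ′` only (cell pub-balaban-gaps, seat g1-p2 gen 5)

HONEST DEPENDENCY (cell pub-balaban, verbatim): continuum YM on T⁴ ⇐ BetaPertH ∧ nine spine estimates (0/9 proved);
BetaPertH ⇐ (D1) ∧ (D4) ∧ CAP+tail.

[B9] Thms 3.1–3.3 (3.42) p. 399, Cor 3.6 p. 408, Thm 3.7 (3.87)–(3.90) p. 409, Cor 3.8 p. 410, Thm 3.10 (3.107)–(3.108) p. 416;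
[II] (1.11) p. 5, p. 13, p. 15, (2.16) p. 16.  `acrossSmall_accretive`: for a family of parametrix model members whose skeleton
coefficients ARE the accretive local inverses `extend((compress (1 + K′(u)) (Es □))⁻¹)` (hypothesis `hop`), the (v)⁺ package
of `D4WalkModelParametrix.acrossSmall_parametrix` is met from: skeleton geometry `(r, m_J, n_D, n_C)`; partition data
(`|h| ≤ 1`, supports with `r₁`-neighbourhood cubes inside the domains, `1∕M`-Lipschitz in a symmetric site pseudo-distance `ds`
with `ds(j,j) = 0`); `K′` entrywise holomorphic on the `R`-ball, range `r₁`, block bound `C_K`; `1 + K′(u)` conjugated-coercive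
`m` at rate `κ_c` along every column weight uniformly on the ball; site row sum `c_s`; one cube row sum `(μ, c_μ)` per member;
rows `Rσ₀`-far from `X`; rates; margin `q < 1` with `C_L = c_s∕m`, `λ_K = (r₁∕M)C_K` — a condition `M ≥ M₀` at fixed letters;
numerics `0 ≤ α < R`, `2·max(K̄_glued,1)·(e^{−(ε₀−3μ)Rσ₀} + α∕R) ≤ θ₀`.  Composition BY NAME of `acrossSmall_parametrix` with
`differentiableOn_locInv`, `blockNorm_locInv_le`, `blockNorm_comm_le`, `comm_blocks_subset`.
WHAT IT IS NOT: Bałaban's `Δ^{(k)}(Z₀,σ,𝐔,𝐉)` as such a family with k-UNIFORM `(C_K, m, κ_c, c_s)` on the small-field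
analyticity domain — THE remaining one-scale operator letter (= [B9] Thms 3.1–3.3); the multi-scale structure (NODE O.2
(i)–(iv)), (v) for HIS family, `TermDomination` remain; (D4) instance 0∕1; words UNCHANGED.
-/

noncomputable section

namespace Summit.QuantumFields.BalabanUV.Gaps.D4WalkModelAccretive

open Metric Set Finset
open Literature.MathematicalPhysics.QuantumFieldTheory.Balaban1983to89
open Literature.MathematicalPhysics.QuantumFieldTheory.Balaban1983to89.B9Thm34Ext (toB6)
open Literature.MathematicalPhysics.QuantumFieldTheory.Balaban1983to89.B9Thm37GlueTorus (torusGeom tdist1)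
open Literature.MathematicalPhysics.QuantumFieldTheory.Balaban1983to89.B5TorusCover (UT)
open Literature.MathematicalPhysics.QuantumFieldTheory.Balaban1983to89.B11SectG (RowSum)
open Literature.MathematicalPhysics.QuantumFieldTheory.Balaban1983to89.B5Prop11Lower (nsq)
open Literature.MathematicalPhysics.QuantumFieldTheory.Balaban1983to89.B13TermWalkDataOneTorus (ExistsUniformAcrossSmall)
open Summit.QuantumFields.BalabanUV.Gaps.D4WalkBlock (blockNorm)
open Summit.QuantumFields.BalabanUV.Gaps.D4WalkModelParametrix (ParametrixModelMember acrossSmall_parametrix)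
open Summit.QuantumFields.BalabanUV.Gaps.D4WalkBlockCommutator (blockNorm_comm_le comm_blocks_subset)
open Summit.QuantumFields.BalabanUV.Gaps.D4WalkBlockLocalInverse (differentiableOn_locInv blockNorm_locInv_le)
open Summit.QuantumFields.BalabanUV.Beta.UnitLatticeWalkInversion (Hd)
open Summit.QuantumFields.BalabanUV.Beta.UnitLatticeLocalInverse (compress extend)
open Summit.QuantumFields.BalabanUV.Beta.AccretiveCombesThomas (conjForm)

variable {d : ℕ} {c : B13.Consts}

/-- **(v)⁺ ACROSS A FAMILY OF TORI FOR THE INVERSE OF A UNIFORMLY ACCRETIVE, FINITE-RANGE, HOLOMORPHIC `Δ′(u)` — LETTERS ON `Δ′`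
ONLY, COMMON ACROSS THE FAMILY.**  See the module docstring for the letter list; the three printed smallness sources sit on `M`
(margin, via `λ_K = (r₁∕M)C_K`), `Rσ₀` (σ, geometric) and `α∕R` (analyticity). [cite: Balaban1985BackgroundPropagators, Thms 3.1–3.3 (3.42) p.399, Cor 3.6 p.408, Thm 3.7 p.409, Cor 3.8 p.410, Thm 3.10 p.416; Balaban1988RG2Cluster, (1.11) p.5, p.13, p.15, (2.16) p.16] -/
theorem acrossSmall_accretive {S : Type*} (𝓜 : S → ParametrixModelMember d)
    (ds : ∀ s (i : (𝓜 s).ι), ((𝓜 s).t i).n → ((𝓜 s).t i).n → ℝ)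
    {R CK M m κc cs r₁ r : ℝ} {mJ nD nC : ℕ} {ρ₀ ε₀ κ₀ μ cμ Rσ₀ α θ₀ : ℝ}
    (hop : ∀ s (i : (𝓜 s).ι) b u,
      ((𝓜 s).t i).L.op b u = extend (compress (1 + ((𝓜 s).t i).K' u) (((𝓜 s).t i).Es b))⁻¹)
    (hanchor : ∀ s (i : (𝓜 s).ι) b, ((𝓜 s).t i).L.anchor b ∈ ((𝓜 s).t i).L.dom b)
    (hdiam : ∀ s (i : (𝓜 s).ι) b, ∀ z ∈ ((𝓜 s).t i).L.dom b, ∀ z' ∈ ((𝓜 s).t i).L.dom b, tdist1 (𝓜 s).K z z' ≤ r)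
    (hJ : ∀ s (i : (𝓜 s).ι) b, (((𝓜 s).t i).L.J b).card ≤ mJ)
    (hX : ∀ s (i : (𝓜 s).ι) b, (((𝓜 s).t i).L.J b).Nonempty → (((𝓜 s).t i).L.dom b ∩ ((𝓜 s).t i).X).Nonempty)
    (hmult : ∀ s (i : (𝓜 s).ι) (z : UT (𝓜 s).K), (Finset.univ.filter fun b => ((𝓜 s).t i).L.anchor b = z).card ≤ nD)
    (hcard : ∀ s (i : (𝓜 s).ι) b, (((𝓜 s).t i).L.dom b).card ≤ nC)
    (hsupp : ∀ s (i : (𝓜 s).ι) b y, y ∉ ((𝓜 s).t i).Es b → ((𝓜 s).t i).h b y = 0)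
    (habs : ∀ s (i : (𝓜 s).ι) b y, |((𝓜 s).t i).h b y| ≤ 1)
    (hE : ∀ s (i : (𝓜 s).ι) b y, y ∈ ((𝓜 s).t i).Es b → ((𝓜 s).t i).cubn y ∈ ((𝓜 s).t i).L.dom b)
    (hLip : ∀ s (i : (𝓜 s).ι) b k l, |((𝓜 s).t i).h b k - ((𝓜 s).t i).h b l| ≤ ds s i k l / M)
    (hdomE : ∀ s (i : (𝓜 s).ι) b k, (∃ l ∈ ((𝓜 s).t i).Es b, ds s i k l ≤ r₁) → ((𝓜 s).t i).cubn k ∈ ((𝓜 s).t i).L.dom b)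
    (hsymm : ∀ s (i : (𝓜 s).ι) k l, ds s i k l = ds s i l k) (hd0 : ∀ s (i : (𝓜 s).ι) l, ds s i l l = 0)
    (hKan : ∀ s (i : (𝓜 s).ι) k l, DifferentiableOn ℂ (fun u => ((𝓜 s).t i).K' u k l) (ball (0 : (𝓜 s).E) R))
    (hKbd : ∀ s (i : (𝓜 s).ι), ∀ u ∈ ball (0 : (𝓜 s).E) R, ∀ y y',
      blockNorm ((𝓜 s).t i).cubn ((𝓜 s).t i).cubn (((𝓜 s).t i).K' u) y y' ≤ CK)
    (hKrange : ∀ s (i : (𝓜 s).ι) u k l, ((𝓜 s).t i).K' u k l ≠ 0 → ds s i k l ≤ r₁)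
    (hcoer : ∀ s (i : (𝓜 s).ι), ∀ u ∈ ball (0 : (𝓜 s).E) R, ∀ j, ∀ z : ((𝓜 s).t i).n → ℂ,
      m * nsq z ≤ (conjForm (1 + ((𝓜 s).t i).K' u) κc (fun e => ds s i e j) z).re)
    (hsite : ∀ s (i : (𝓜 s).ι) k, ∑ l, Real.exp (-(κc * ds s i k l)) ≤ cs)
    (hrow : ∀ s, RowSum (toB6 (torusGeom (𝓜 s).K 0 0 0) 0 True) μ cμ)
    (hfar : ∀ s (i : (𝓜 s).ι) (b : ((𝓜 s).t i).Λ), ∀ z ∈ ((𝓜 s).t i).X,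
      Rσ₀ ≤ tdist1 (𝓜 s).K (((𝓜 s).t i).cubn (((𝓜 s).t i).rowOf b)) z)
    (hκ₁ : 0 ≤ c.κ₁) (hCK : 0 ≤ CK) (hM : 0 < M) (hm : 0 < m) (hκc : 0 ≤ κc) (hcs : 0 ≤ cs) (hr₁ : 0 ≤ r₁)
    (hμ : 0 ≤ μ) (hμε : 3 * μ ≤ ε₀) (hμκ : 2 * μ < κ₀) (hwin : κ₀ + μ ≤ ρ₀ - ε₀) (hcμ : 0 ≤ cμ)
    (hq : cμ * (cμ * 1 *
      (1 * (((nC * (r₁ / M * CK) * (cs / m)) * Real.exp (c.κ₁ * mJ) * Real.exp (2 * ρ₀ * r)) * Real.exp (μ * r) *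
        (nD * cμ))) * cμ) * cμ < 1)
    (hα : 0 ≤ α) (hαR : α < R)
    (hθ : 2 * max (cμ * (((cs / m) * Real.exp (c.κ₁ * mJ) * Real.exp (2 * ρ₀ * r)) * Real.exp (μ * r) * (nD * cμ)) *
          (1 * (1 - cμ * (cμ * 1 *
            (1 * (((nC * (r₁ / M * CK) * (cs / m)) * Real.exp (c.κ₁ * mJ) * Real.exp (2 * ρ₀ * r)) * Real.exp (μ * r) *
              (nD * cμ))) * cμ) * cμ)⁻¹) * cμ) 1
        * (Real.exp (-((ε₀ - 3 * μ) * Rσ₀)) + α / R) ≤ θ₀) :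
    ExistsUniformAcrossSmall (fun s => (𝓜 s).toTorusTerms c) α Rσ₀ θ₀ :=
  acrossSmall_parametrix 𝓜 hanchor hdiam hJ hX hmult hsupp habs hE
    (fun s i b k l => by
      have e : (fun u => ((𝓜 s).t i).L.op b u k l) =
          fun u => extend (compress (1 + ((𝓜 s).t i).K' u) (((𝓜 s).t i).Es b))⁻¹ k l := funext fun u => by rw [hop]
      rw [e]
      exact differentiableOn_locInv (((𝓜 s).t i).Es b) (ds s i) hm
        (fun k' l' => by simp only [Matrix.add_apply]; exact (differentiableOn_const _).add (hKan s i k' l')) (hcoer s i) k l)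
    (fun s i b u hu y y' => by
      rw [hop s i b u]
      exact blockNorm_locInv_le ((𝓜 s).t i).cubn (1 + ((𝓜 s).t i).K' u) (((𝓜 s).t i).Es b) (ds s i) (hd0 s i) hκc hm
        (hcoer s i u hu) hcs (hsite s i) y y')
    hKan
    (fun s i b u hu y y' => (blockNorm_comm_le ((𝓜 s).t i).cubn ((𝓜 s).t i).h (ds s i) hM hr₁ (hLip s i)
      (((𝓜 s).t i).K' u) (hKrange s i u) b y y').trans (mul_le_mul_of_nonneg_left (hKbd s i u hu y y') (div_nonneg hr₁ hM.le)))
    (fun s i b u y y' hne => comm_blocks_subset ((𝓜 s).t i).cubn ((𝓜 s).t i).h ((𝓜 s).t i).Es (hsupp s i) (ds s i)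
      (hsymm s i) (fun l => by rw [hd0 s i]; exact hr₁) (((𝓜 s).t i).K' u) (hKrange s i u) ((𝓜 s).t i).L.dom (hdomE s i)
      b y y' hne)
    hcard hrow hfar hκ₁ (div_nonneg hcs hm.le) (mul_nonneg (div_nonneg hr₁ hM.le) hCK) hμ hμε hμκ hwin hcμ hq hα hαR hθ

end Summit.QuantumFields.BalabanUV.Gaps.D4WalkModelAccretive

end
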